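import Literature.RepresentationTheory.Ichino2022.FockKTypeCorrespondence

/-!
# Ichino (2022) Lemma 7.10 in the rank-one Fock model `ℂ[z]` of `(U(1), U(1)) ⊂ Sp₂(ℝ)` — the SIGN ANCHOR

For `(p,q;r,s) = (1,0;1,0)` the Fock model is `ℂ[z]`; both compact groups `U(W) = U(1)` and `U(V) = U(1)` act through
the DEGREE (`𝔭′ = 0`: every vector is harmonic; no raising operators), and [Ich22] Lemma 7.10 says that `z^a` carries
`U(W)`-weight `a + 1/2 + m₀/2` and `U(V)`-weight `a + 1/2 + n₀/2` — POSITIVE in the degree on BOTH sides.  This pins the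
sign convention of [Ich22] §4.1 (`ψ(x) = e^{−2π√−1x}`): a realisation of the oscillator representation restricted to
`U(1) × U(1)` in which both circles act on the degree-`a` Fock monomial by `+a` (plus the vacuum character) is in
Ichino's sign; the Folland-normalised action `F ↦ F ∘ U⁻¹` (weight `−a`) is its conjugate.

* `IsHWOne f k` — non-zero and weighted-homogeneous of degree `k` (Mathlib `IsWeightedHomogeneous`);
* `isHWOne_iff` — exactly the multiples `c·z^a`;
* `explicitRankOne S : FockHarmonics S`, **`lemma_7_10_explicitRankOne`** (`p = r = 1`, `q = s = 0`).

## References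
* A. Ichino, Adv. Math. 398 (2022) 108188, §4.1, §7.5 Lemma 7.10. [Ichino2022ThetaReal]
-/

namespace Literature.RepresentationTheory.Ichino2022

namespace ExplicitRankOne

open MvPolynomial Finsupp FockHarmonics HarmonicParam

/-- The rank-one Fock model `ℂ[z]`. [cite: Ichino2022ThetaReal, §7.5] -/
abbrev Model : Type := MvPolynomial Unit ℂ

/-- the degree weight (both `U(1)`s act through it). [cite: Ichino2022ThetaReal, §7.5 Lemma 7.10] -/
def degW : Unit → ℤ := fun _ => 1

/-- [folklore] -/
theorem weight_degW (d : Unit →₀ ℕ) : weight degW d = (d () : ℤ) := by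
  rw [weight_apply, Finsupp.sum_fintype _ _ (by simp)]
  simp [degW]

/-- **Joint weight vector of the rank-one model**: non-zero, weighted-homogeneous of degree `k`.
[cite: Ichino2022ThetaReal, §7.5 Lemma 7.10] -/
structure IsHWOne (f : Model) (k : ℤ) : Prop where
  /-- non-zero -/
  ne : f ≠ 0
  /-- degree `k` -/
  deg : IsWeightedHomogeneous degW f k

/-- **Classification**: exactly `c·z^a`, `a ≥ 0`, of weight `a`. [cite: Ichino2022ThetaReal, §7.5 Lemma 7.10] -/
theorem isHWOne_iff (f : Model) (k : ℤ) :
    IsHWOne f k ↔ ∃ (a : ℕ) (c : ℂ), c ≠ 0 ∧ f = c • (X () : Model) ^ a ∧ k = a := by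
  classical
  constructor
  · intro H
    have key : ∀ m ∈ f.support, (m () : ℤ) = k := by
      intro m hm
      have := H.deg (MvPolynomial.mem_support_iff.mp hm)
      rwa [weight_degW] at this
    obtain ⟨m₀, hm₀⟩ : ∃ m, m ∈ f.support := by
      by_contra hno
      apply H.ne
      ext m
      rw [coeff_zero]
      by_contra hne
      exact hno ⟨m, MvPolynomial.mem_support_iff.mpr hne⟩
    have hk : 0 ≤ k := by have := key m₀ hm₀; omega
    have hM : ∀ m ∈ f.support, m = single () k.toNat := by
      intro m hm
      apply Finsupp.unique_ext
      have := key m hm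
      rw [show (default : Unit) = () from rfl, single_eq_same]
      omega
    refine ⟨k.toNat, coeff (single () k.toNat) f, ?_, ?_, by omega⟩
    · intro h0
      apply (MvPolynomial.mem_support_iff.mp hm₀)
      rw [hM m₀ hm₀]; exact h0
    · rw [X_pow_eq_monomial, smul_monomial, smul_eq_mul, mul_one]
      ext m
      rw [coeff_monomial]
      by_cases hm : single () k.toNat = m
      · rw [if_pos hm, hm]
      · rw [if_neg hm]
        by_contra hne
        exact hm (hM m (MvPolynomial.mem_support_iff.mpr hne)).symm
  · rintro ⟨a, c, hc, rfl, rfl⟩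
    refine ⟨?_, ?_⟩
    · rw [X_pow_eq_monomial, smul_monomial, smul_eq_mul, mul_one, Ne, monomial_eq_zero]; exact hc
    · rw [X_pow_eq_monomial, smul_monomial, smul_eq_mul, mul_one]
      exact isWeightedHomogeneous_monomial _ _ _ (by rw [weight_degW]; simp)

/-- **The [Ich22] dictionary of the rank-one model**: `μ ⊠ μ′` corresponds iff a monomial `z^a` has the weights
`(μ; μ′)` minus the printed shifts `(r−s)/2 + m₀/2` and `(p−q)/2 + n₀/2`. [cite: Ichino2022ThetaReal, §7.5 Lemma 7.10] -/
def explicitRankOne (S : SplittingDatum) : FockHarmonics S where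
  corresponds μ μ' := ∃ (f : Model) (k : ℤ), IsHWOne f k ∧
    (∀ i, μ.1 i = (k : ℚ) + ((S.r : ℚ) - S.s) / 2 + (S.m₀ : ℚ) / 2) ∧
    (∀ i, μ'.1 i = (k : ℚ) + ((S.p : ℚ) - S.q) / 2 + (S.n₀ : ℚ) / 2)

/-- **Ichino's Lemma 7.10 HOLDS in the rank-one model** (`(p,q;r,s) = (1,0;1,0)`): both circles act on `z^a` by
`+a` plus their vacuum characters. [cite: Ichino2022ThetaReal, §7.5 Lemma 7.10] -/
theorem lemma_7_10_explicitRankOne (S : SplittingDatum) (hp : S.p = 1) (hq : S.q = 0) (hr : S.r = 1)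
    (hs : S.s = 0) : (explicitRankOne S).Lemma_7_10 := by
  intro μ μ'
  show (∃ (f : Model) (k : ℤ), IsHWOne f k ∧ _) ↔ _
  constructor
  · rintro ⟨f, k, hf, hμ, hμ'⟩
    obtain ⟨a, c, -, -, rfl⟩ := (isHWOne_iff f k).mp hf
    by_cases ha : a = 0
    · subst ha
      refine ⟨HarmonicParam.vacuum S, ?_, ?_⟩
      · rw [HarmonicParam.vacuum_mu]
        ext i
        · rw [hμ i]; push_cast; ring
        · exact (Fin.cast hq i).elim0
      · rw [HarmonicParam.vacuum_mu']
        ext i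
        · rw [hμ' i]; push_cast; ring
        · exact (Fin.cast hs i).elim0
    · have ha1 : 0 < (a : ℤ) := by omega
      let P : HarmonicParam S :=
        { pp := 1, pm := 0, qp := 0, qm := 0, a := fun _ => a, b := Fin.elim0, c := Fin.elim0, d := Fin.elim0
          a_anti := fun _ _ _ => le_rfl, b_anti := fun i => i.elim0, c_anti := fun i => i.elim0
          d_anti := fun i => i.elim0, a_pos := fun _ => ha1, b_neg := fun i => i.elim0
          c_pos := fun i => i.elim0, d_neg := fun i => i.elim0
          hp := by omega, hq := by omega, hr := by omega, hs := by omega }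
      refine ⟨P, ?_, ?_⟩
      · ext i
        · rw [hμ i, mu_fst_apply, pad_head _ _ _ _ (by show i.val < 1; omega)]
        · exact (Fin.cast hq i).elim0
      · ext i
        · rw [hμ' i, mu'_fst_apply, pad_head _ _ _ _ (by show i.val < 1; omega)]
        · exact (Fin.cast hs i).elim0
  · rintro ⟨P, hμ, hμ'⟩
    have hPq : P.qp + P.qm ≤ S.q := P.hq
    have hPs : P.pm + P.qp ≤ S.s := P.hs
    have hPp : P.pp + P.pm ≤ S.p := P.hp
    have hqm : P.qm = 0 := by omega
    have hqp : P.qp = 0 := by omega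
    have hpm : P.pm = 0 := by omega
    rcases Nat.lt_or_ge 0 P.pp with hpp | hpp
    · have ha := P.a_pos ⟨0, hpp⟩
      have hcast : (((P.a ⟨0, hpp⟩).toNat : ℤ) : ℚ) = (P.a ⟨0, hpp⟩ : ℚ) := by
        exact_mod_cast Int.toNat_of_nonneg ha.le
      refine ⟨_, _, (isHWOne_iff _ _).mpr ⟨(P.a ⟨0, hpp⟩).toNat, 1, one_ne_zero, rfl, rfl⟩, ?_, ?_⟩
      · intro i
        rw [hμ, mu_fst_apply, pad_head _ _ _ _ (by omega)]
        have : P.a ⟨i.val, by omega⟩ = P.a ⟨0, hpp⟩ := by congr 1; exact Fin.ext (by have := i.isLt; omega)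
        rw [this, hcast]
      · intro i
        rw [hμ', mu'_fst_apply, pad_head _ _ _ _ (by omega)]
        have : P.a ⟨i.val, by omega⟩ = P.a ⟨0, hpp⟩ := by congr 1; exact Fin.ext (by have := i.isLt; omega)
        rw [this, hcast]
    · have hpp0 : P.pp = 0 := by omega
      refine ⟨_, _, (isHWOne_iff _ _).mpr ⟨0, 1, one_ne_zero, rfl, rfl⟩, ?_, ?_⟩
      · intro i
        rw [hμ, mu_fst_apply, pad_mid _ _ _ _ (by omega) (by have := i.isLt; omega)]
        push_cast; ring
      · intro i
        rw [hμ', mu'_fst_apply, pad_mid _ _ _ _ (by omega) (by have := i.isLt; omega)]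
        push_cast; ring

end ExplicitRankOne

end Literature.RepresentationTheory.Ichino2022
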